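import Mathlib
import Summits.Ventures.PercRepro2.SeriesContract

/-!
# The series CONTRACTION of (HMF) and (HCOV) (blind cell PercRepro2, night-1 g15; NIGHT1-G15.md §4
— the mass level of `SeriesContract`, the Lean form of the S3 (1) «skeleton reduction», series rule)

With the sure edge `f' = {v, w'}` (`p f' = 1`) every mass of `HMFc` and `Gc` is unchanged by
re-ending `f = {v, w}` to `{w, w'}` (`HMFc_reend_of_sure`, `Gc_reend_of_sure`: the events agree on
`{f' open}` — `SeriesContract.conn_reend_iff`, `cluster_reend`, `connDelEvent_reend_inter_open` —
and `HMFSureEdge.prob_eq_of_inter_open`).  After the re-ending `v` is an unmarked leaf, invisible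
to both functionals (`HMFLeafInvisible.HMFc_update_leaf`, `Gc_update_leaf`).  With the series
reduction of `SeriesHMF` this gives

**`HMF p ends ↔ HMF p[f ↦ p f · p f', f' ↦ 0] ends[f ↦ {w, w'}]`** (`HMF_series_contract`) and
**`HCov p ends ↔ HCov p[f ↦ p f · p f', f' ↦ 0] ends[f ↦ {w, w'}]`** (`HCov_series_contract`):

an unmarked vertex `v` of degree two with neighbours `w, w'` (weights `p₁, p₂`) is replaced by the
single edge `{w, w'}` of weight `p₁ p₂` (`v` left isolated) — every graph, every weight vector, `w = w'`
allowed, no hypothesis on `w, w'`.  With the leaf rule (`StarH.HMF_delete_leaf`) the crux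
(HCOV)/(HMF) is reduced to graphs without unmarked vertices of degree `≤ 2`.
-/

open scoped Classical

namespace Summit.Ventures.PercRepro2

open UnionCluster CovForm PendantRoot

namespace SeriesCollapse
section Masses

variable {V : Type*} {E : Type*} [Fintype E] [DecidableEq E] [Fintype V] [DecidableEq V]
  {R : Type*} [Field R] [LinearOrder R] [IsStrictOrderedRing R] {ends : E → Sym2 V} {v w w' : V}
  {f f' : E}

omit [Fintype V] [DecidableEq V] in
/-- Events that agree on `{f' open}` have the same probability when `f'` is sure. -/
lemma prob_reend_of_iff (p : E → R) (hp : IsProbVec p) (h1 : p f' = 1) {A B : Set (Config E)}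
    (h : ∀ ω, ω f' = true → (ω ∈ A ↔ ω ∈ B)) : prob p A = prob p B :=
  HMFSureEdge.prob_eq_of_inter_open p hp h1 (inter_open_eq_of_iff h)

omit [Fintype E] [DecidableEq E] [Fintype V] [DecidableEq V] in
/-- The pointwise form of an agreement on `{f' open}`. -/
lemma iff_of_inter_open_eq {A B : Set (Config E)} (h : A ∩ openEdge f' = B ∩ openEdge f')
    {ω : Config E} (hω : ω f' = true) : ω ∈ A ↔ ω ∈ B := by
  have := Set.ext_iff.1 h ω
  simpa only [Set.mem_inter_iff, mem_openEdge, hω, and_true] using this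

/-- **The residual terms are unchanged by the re-ending** (for the removed sets that occur). -/
theorem termW_reend_of_sure (p : E → R) (hp : IsProbVec p) (h1 : p f' = 1) (hf : ends f = s(v, w))
    (hf' : ends f' = s(v, w')) (hdeg : ∀ e, v ∈ ends e → e = f ∨ e = f') (hvw : v ≠ w)
    (hvw' : v ≠ w') {W : Finset V} (hW : v ∈ W → w' ∈ W) {o a₁ a₂ b : V} (ho : o ≠ v)
    (h1' : a₁ ≠ v) (h2 : a₂ ≠ v) (hb : b ≠ v) :
    termW p ends o a₁ a₂ b W = termW p (Function.update ends f s(w, w')) o a₁ a₂ b W := by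
  have hcs : ∀ x y : V, x ≠ v → y ≠ v → connDelEvent ends W x y ∩ openEdge f' =
      connDelEvent (Function.update ends f s(w, w')) W x y ∩ openEdge f' :=
    fun x y hx hy => connDelEvent_reend_inter_open hf hf' hdeg hvw hvw' hW hx hy
  have hQs := delQ_reend_inter_open hf hf' hdeg hvw hvw' hW h1' h2
  have hc : ∀ x y : V, x ≠ v → y ≠ v → prob p (connDelEvent ends W x y) =
      prob p (connDelEvent (Function.update ends f s(w, w')) W x y) :=
    fun x y hx hy => HMFSureEdge.prob_eq_of_inter_open p hp h1 (hcs x y hx hy)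
  have hQ : prob p (delQ ends W a₁ a₂) = prob p (delQ (Function.update ends f s(w, w')) W a₁ a₂) :=
    HMFSureEdge.prob_eq_of_inter_open p hp h1 hQs
  have hQc : ∀ x y : V, x ≠ v → y ≠ v →
      prob p (delQ ends W a₁ a₂ ∩ connDelEvent ends W x y) =
        prob p (delQ (Function.update ends f s(w, w')) W a₁ a₂ ∩
          connDelEvent (Function.update ends f s(w, w')) W x y) := fun x y hx hy =>
    prob_reend_of_iff p hp h1 fun ω hω => by
      simp only [Set.mem_inter_iff]
      rw [iff_of_inter_open_eq hQs hω, iff_of_inter_open_eq (hcs x y hx hy) hω]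
  simp only [termW, termT, termPD, delConnProb, delShareMass, hQ, hc _ _ h1' ho, hc _ _ h2 ho,
    hc _ _ h1' hb, hc _ _ h2 hb, hQc _ _ h1' ho, hQc _ _ h2 ho, hQc _ _ h1' hb, hQc _ _ h2 hb]

/-- **The mean field `X̂` is unchanged by the re-ending.** -/
theorem Xhat_reend_of_sure (p : E → R) (hp : IsProbVec p) (h1 : p f' = 1) (hff : f ≠ f')
    (hf : ends f = s(v, w)) (hf' : ends f' = s(v, w')) (hdeg : ∀ e, v ∈ ends e → e = f ∨ e = f')
    (hvw : v ≠ w) (hvw' : v ≠ w') {o a₁ a₂ a₃ b : V} (ho : o ≠ v) (h1' : a₁ ≠ v) (h2 : a₂ ≠ v)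
    (h3 : a₃ ≠ v) (hb : b ≠ v) :
    Xhat p ends o a₁ a₂ a₃ b = Xhat p (Function.update ends f s(w, w')) o a₁ a₂ a₃ b := by
  rw [Xhat_eq_sum, Xhat_eq_sum]
  refine Finset.sum_congr rfl fun W _ => ?_
  have hcl : prob p (clusterEvent ends a₃ (↑W : Set V)) =
      prob p (clusterEvent (Function.update ends f s(w, w')) a₃ (↑W : Set V)) :=
    prob_reend_of_iff p hp h1 fun ω hω => by
      simp only [mem_clusterEvent]
      rw [cluster_reend hff hf hf' hdeg hvw hvw' hω h3]
  by_cases hv : v ∈ W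
  · by_cases hw' : w' ∈ W
    · rw [hcl, termW_reend_of_sure p hp h1 hf hf' hdeg hvw hvw' (fun _ => hw') ho h1' h2 hb]
    · -- `v ∈ W`, `w' ∉ W`: such a cluster of `a₃` does not occur when `f'` is open
      have hz : prob p (clusterEvent ends a₃ (↑W : Set V)) = 0 := by
        rw [← prob_empty p]
        refine prob_reend_of_iff p hp h1 fun ω hω => ?_
        simp only [mem_clusterEvent, Set.mem_empty_iff_false, iff_false]
        intro hc
        have hvc : v ∈ cluster ends ω a₃ := by rw [hc]; exact Finset.mem_coe.2 hv
        have hw'c : w' ∈ cluster ends ω a₃ := conn_trans hvc (conn_of_openAdj ⟨f', hω, hf'⟩)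
        rw [hc] at hw'c
        exact hw' (Finset.mem_coe.1 hw'c)
      rw [← hcl, hz, zero_mul, zero_mul]
  · rw [hcl, termW_reend_of_sure p hp h1 hf hf' hdeg hvw hvw' (fun h => absurd h hv) ho h1' h2 hb]

/-- **The mean-field functional is unchanged by the re-ending across the sure edge.** -/
theorem HMFc_reend_of_sure (p : E → R) (hp : IsProbVec p) (h1 : p f' = 1) (hff : f ≠ f')
    (hf : ends f = s(v, w)) (hf' : ends f' = s(v, w')) (hdeg : ∀ e, v ∈ ends e → e = f ∨ e = f')
    (hvw : v ≠ w) (hvw' : v ≠ w') {o a₁ a₂ a₃ b : V} (ho : o ≠ v) (h1' : a₁ ≠ v) (h2 : a₂ ≠ v)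
    (h3 : a₃ ≠ v) (hb : b ≠ v) :
    HMFc p ends o a₁ a₂ a₃ b = HMFc p (Function.update ends f s(w, w')) o a₁ a₂ a₃ b := by
  have hcon : ∀ ω : Config E, ω f' = true → ∀ x y : V, x ≠ v → y ≠ v →
      (Conn ends ω x y ↔ Conn (Function.update ends f s(w, w')) ω x y) :=
    fun ω hω x y hx hy => conn_reend_iff hf hf' hdeg hvw hvw' hω hx hy
  have key : ∀ A B : Set (Config E), (∀ ω, ω f' = true → (ω ∈ A ↔ ω ∈ B)) →
      prob p A = prob p B := fun A B h => prob_reend_of_iff p hp h1 h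
  have hcc : ∀ x y : V, x ≠ v → y ≠ v → ∀ ω : Config E, ω f' = true →
      (ω ∈ connEvent ends x y ↔ ω ∈ connEvent (Function.update ends f s(w, w')) x y) :=
    fun x y hx hy ω hω => by simp only [mem_connEvent]; exact hcon ω hω x y hx hy
  have hc : ∀ x y : V, x ≠ v → y ≠ v → prob p (connEvent ends x y) =
      prob p (connEvent (Function.update ends f s(w, w')) x y) :=
    fun x y hx hy => key _ _ (hcc x y hx hy)
  have hQ : prob p (avoidAll ends a₂ {a₁}) =
      prob p (avoidAll (Function.update ends f s(w, w')) a₂ {a₁}) := by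
    rw [avoidAll_eq_compl, avoidAll_eq_compl]
    exact key _ _ fun ω hω => by
      simp only [Set.mem_compl_iff, mem_connEvent, hcon ω hω a₁ a₂ h1' h2]
  have hQc : ∀ x y : V, x ≠ v → y ≠ v →
      prob p (avoidAll ends a₂ {a₁} ∩ connEvent ends x y) =
        prob p (avoidAll (Function.update ends f s(w, w')) a₂ {a₁} ∩
          connEvent (Function.update ends f s(w, w')) x y) := fun x y hx hy => by
    rw [avoidAll_eq_compl, avoidAll_eq_compl]
    exact key _ _ fun ω hω => by
      simp only [Set.mem_inter_iff, Set.mem_compl_iff, mem_connEvent, hcon ω hω a₁ a₂ h1' h2,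
        hcon ω hω x y hx hy]
  have hPD : prob p (PDEvent ends a₁ a₂ a₃) =
      prob p (PDEvent (Function.update ends f s(w, w')) a₁ a₂ a₃) :=
    key _ _ fun ω hω => by
      simp only [PDEvent, Dtilde, UnionCluster.inU, Set.mem_inter_iff, Set.mem_compl_iff,
        Set.mem_union, mem_connEvent, hcon ω hω a₁ a₂ h1' h2, hcon ω hω a₃ a₁ h3 h1',
        hcon ω hω a₃ a₂ h3 h2]
  have hPDc : ∀ x y : V, x ≠ v → y ≠ v →
      prob p (PDEvent ends a₁ a₂ a₃ ∩ connEvent ends x y) =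
        prob p (PDEvent (Function.update ends f s(w, w')) a₁ a₂ a₃ ∩
          connEvent (Function.update ends f s(w, w')) x y) := fun x y hx hy =>
    key _ _ fun ω hω => by
      simp only [PDEvent, Dtilde, UnionCluster.inU, Set.mem_inter_iff, Set.mem_compl_iff,
        Set.mem_union, mem_connEvent, hcon ω hω a₁ a₂ h1' h2, hcon ω hω a₃ a₁ h3 h1',
        hcon ω hω a₃ a₂ h3 h2, hcon ω hω x y hx hy]
  have hT : ∀ a b' c : V, a ≠ v → b' ≠ v → c ≠ v → prob p (TEvent ends a b' c) =
      prob p (TEvent (Function.update ends f s(w, w')) a b' c) := fun a b' c ha hb' hc' =>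
    key _ _ fun ω hω => by
      simp only [TEvent, Set.mem_inter_iff, Set.mem_compl_iff, mem_connEvent,
        hcon ω hω b' a hb' ha, hcon ω hω b' c hb' hc']
  have hTc : ∀ a b' c x y : V, a ≠ v → b' ≠ v → c ≠ v → x ≠ v → y ≠ v →
      prob p (TEvent ends a b' c ∩ connEvent ends x y) =
        prob p (TEvent (Function.update ends f s(w, w')) a b' c ∩
          connEvent (Function.update ends f s(w, w')) x y) := fun a b' c x y ha hb' hc' hx hy =>
    key _ _ fun ω hω => by
      simp only [TEvent, Set.mem_inter_iff, Set.mem_compl_iff, mem_connEvent,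
        hcon ω hω b' a hb' ha, hcon ω hω b' c hb' hc', hcon ω hω x y hx hy]
  have hcT : ∀ x y a b' c : V, x ≠ v → y ≠ v → a ≠ v → b' ≠ v → c ≠ v →
      prob p (connEvent ends x y ∩ TEvent ends a b' c) =
        prob p (connEvent (Function.update ends f s(w, w')) x y ∩
          TEvent (Function.update ends f s(w, w')) a b' c) := fun x y a b' c hx hy ha hb' hc' =>
    key _ _ fun ω hω => by
      simp only [TEvent, Set.mem_inter_iff, Set.mem_compl_iff, mem_connEvent,
        hcon ω hω b' a hb' ha, hcon ω hω b' c hb' hc', hcon ω hω x y hx hy]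
  simp only [HMFc, marginC, DEF, Do, EQo, EQ3, EQ3o, massM2, deltaT, gap]
  rw [Xhat_reend_of_sure p hp h1 hff hf hf' hdeg hvw hvw' ho h1' h2 h3 hb]
  simp only [hQ, hPD, hQc _ _ h1' ho, hQc _ _ h2 ho, hPDc _ _ h1' ho, hPDc _ _ h2 ho,
    hPDc _ _ h2 hb, hT a₁ a₂ a₃ h1' h2 h3, hT a₂ a₁ a₃ h2 h1' h3, hc _ _ h2 hb, hc _ _ h1' hb,
    hTc a₁ a₂ a₃ _ _ h1' h2 h3 h1' ho, hTc a₁ a₂ a₃ _ _ h1' h2 h3 h2 ho,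
    hTc a₂ a₁ a₃ _ _ h2 h1' h3 h1' ho, hTc a₂ a₁ a₃ _ _ h2 h1' h3 h2 ho,
    hcT _ _ a₁ a₂ a₃ h2 hb h1' h2 h3, hcT _ _ a₁ a₂ a₃ h1' hb h1' h2 h3]

omit [Fintype V] [DecidableEq V] in
/-- **The cleared (HCOV) functional is unchanged by the re-ending across the sure edge.** -/
theorem Gc_reend_of_sure (p : E → R) (hp : IsProbVec p) (h1 : p f' = 1) (hf : ends f = s(v, w))
    (hf' : ends f' = s(v, w')) (hdeg : ∀ e, v ∈ ends e → e = f ∨ e = f') (hvw : v ≠ w)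
    (hvw' : v ≠ w') {o a₁ a₂ a₃ b : V} (ho : o ≠ v) (h1' : a₁ ≠ v) (h2 : a₂ ≠ v) (h3 : a₃ ≠ v)
    (hb : b ≠ v) : Gc p ends o a₁ a₂ a₃ b = Gc p (Function.update ends f s(w, w')) o a₁ a₂ a₃ b := by
  have hcon : ∀ ω : Config E, ω f' = true → ∀ x y : V, x ≠ v → y ≠ v →
      (Conn ends ω x y ↔ Conn (Function.update ends f s(w, w')) ω x y) :=
    fun ω hω x y hx hy => conn_reend_iff hf hf' hdeg hvw hvw' hω hx hy
  have key : ∀ A B : Set (Config E), (∀ ω, ω f' = true → (ω ∈ A ↔ ω ∈ B)) →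
      prob p A = prob p B := fun A B h => prob_reend_of_iff p hp h1 h
  have hc : ∀ x y : V, x ≠ v → y ≠ v → prob p (connEvent ends x y) =
      prob p (connEvent (Function.update ends f s(w, w')) x y) := fun x y hx hy =>
    key _ _ fun ω hω => by simp only [mem_connEvent]; exact hcon ω hω x y hx hy
  have hQc : ∀ x y : V, x ≠ v → y ≠ v →
      prob p (avoidAll ends a₂ {a₁} ∩ connEvent ends x y) =
        prob p (avoidAll (Function.update ends f s(w, w')) a₂ {a₁} ∩
          connEvent (Function.update ends f s(w, w')) x y) := fun x y hx hy => by
    rw [avoidAll_eq_compl, avoidAll_eq_compl]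
    exact key _ _ fun ω hω => by
      simp only [Set.mem_inter_iff, Set.mem_compl_iff, mem_connEvent, hcon ω hω a₁ a₂ h1' h2,
        hcon ω hω x y hx hy]
  have hQcc : ∀ x y x' y' : V, x ≠ v → y ≠ v → x' ≠ v → y' ≠ v →
      prob p (avoidAll ends a₂ {a₁} ∩ (connEvent ends x y ∩ connEvent ends x' y')) =
        prob p (avoidAll (Function.update ends f s(w, w')) a₂ {a₁} ∩
          (connEvent (Function.update ends f s(w, w')) x y ∩
            connEvent (Function.update ends f s(w, w')) x' y')) := fun x y x' y' hx hy hx' hy' => by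
    rw [avoidAll_eq_compl, avoidAll_eq_compl]
    exact key _ _ fun ω hω => by
      simp only [Set.mem_inter_iff, Set.mem_compl_iff, mem_connEvent, hcon ω hω a₁ a₂ h1' h2,
        hcon ω hω x y hx hy, hcon ω hω x' y' hx' hy']
  have hQ : prob p (avoidAll ends a₂ {a₁}) =
      prob p (avoidAll (Function.update ends f s(w, w')) a₂ {a₁}) := by
    rw [avoidAll_eq_compl, avoidAll_eq_compl]
    exact key _ _ fun ω hω => by
      simp only [Set.mem_compl_iff, mem_connEvent, hcon ω hω a₁ a₂ h1' h2]
  have hPD : prob p (PDEvent ends a₁ a₂ a₃) =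
      prob p (PDEvent (Function.update ends f s(w, w')) a₁ a₂ a₃) :=
    key _ _ fun ω hω => by
      simp only [PDEvent, Dtilde, UnionCluster.inU, Set.mem_inter_iff, Set.mem_compl_iff,
        Set.mem_union, mem_connEvent, hcon ω hω a₁ a₂ h1' h2, hcon ω hω a₃ a₁ h3 h1',
        hcon ω hω a₃ a₂ h3 h2]
  have hPDc : ∀ x y : V, x ≠ v → y ≠ v →
      prob p (PDEvent ends a₁ a₂ a₃ ∩ connEvent ends x y) =
        prob p (PDEvent (Function.update ends f s(w, w')) a₁ a₂ a₃ ∩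
          connEvent (Function.update ends f s(w, w')) x y) := fun x y hx hy =>
    key _ _ fun ω hω => by
      simp only [PDEvent, Dtilde, UnionCluster.inU, Set.mem_inter_iff, Set.mem_compl_iff,
        Set.mem_union, mem_connEvent, hcon ω hω a₁ a₂ h1' h2, hcon ω hω a₃ a₁ h3 h1',
        hcon ω hω a₃ a₂ h3 h2, hcon ω hω x y hx hy]
  have hPDcc : ∀ x y x' y' : V, x ≠ v → y ≠ v → x' ≠ v → y' ≠ v →
      prob p (PDEvent ends a₁ a₂ a₃ ∩ (connEvent ends x y ∩ connEvent ends x' y')) =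
        prob p (PDEvent (Function.update ends f s(w, w')) a₁ a₂ a₃ ∩
          (connEvent (Function.update ends f s(w, w')) x y ∩
            connEvent (Function.update ends f s(w, w')) x' y')) := fun x y x' y' hx hy hx' hy' =>
    key _ _ fun ω hω => by
      simp only [PDEvent, Dtilde, UnionCluster.inU, Set.mem_inter_iff, Set.mem_compl_iff,
        Set.mem_union, mem_connEvent, hcon ω hω a₁ a₂ h1' h2, hcon ω hω a₃ a₁ h3 h1',
        hcon ω hω a₃ a₂ h3 h2, hcon ω hω x y hx hy, hcon ω hω x' y' hx' hy']
  have hT : ∀ a b' c : V, a ≠ v → b' ≠ v → c ≠ v → prob p (TEvent ends a b' c) =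
      prob p (TEvent (Function.update ends f s(w, w')) a b' c) := fun a b' c ha hb' hc' =>
    key _ _ fun ω hω => by
      simp only [TEvent, Set.mem_inter_iff, Set.mem_compl_iff, mem_connEvent,
        hcon ω hω b' a hb' ha, hcon ω hω b' c hb' hc']
  have hTc : ∀ a b' c x y : V, a ≠ v → b' ≠ v → c ≠ v → x ≠ v → y ≠ v →
      prob p (TEvent ends a b' c ∩ connEvent ends x y) =
        prob p (TEvent (Function.update ends f s(w, w')) a b' c ∩
          connEvent (Function.update ends f s(w, w')) x y) := fun a b' c x y ha hb' hc' hx hy =>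
    key _ _ fun ω hω => by
      simp only [TEvent, Set.mem_inter_iff, Set.mem_compl_iff, mem_connEvent,
        hcon ω hω b' a hb' ha, hcon ω hω b' c hb' hc', hcon ω hω x y hx hy]
  have hTcc : ∀ a b' c x y x' y' : V, a ≠ v → b' ≠ v → c ≠ v → x ≠ v → y ≠ v → x' ≠ v → y' ≠ v →
      prob p (TEvent ends a b' c ∩ (connEvent ends x y ∩ connEvent ends x' y')) =
        prob p (TEvent (Function.update ends f s(w, w')) a b' c ∩
          (connEvent (Function.update ends f s(w, w')) x y ∩
            connEvent (Function.update ends f s(w, w')) x' y')) :=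
    fun a b' c x y x' y' ha hb' hc' hx hy hx' hy' =>
    key _ _ fun ω hω => by
      simp only [TEvent, Set.mem_inter_iff, Set.mem_compl_iff, mem_connEvent,
        hcon ω hω b' a hb' ha, hcon ω hω b' c hb' hc', hcon ω hω x y hx hy, hcon ω hω x' y' hx' hy']
  simp only [Gc, EQbo, EQb3, EQb3o, Do, gap, DEF, EQo, EQ3, EQ3o, PDb, PDbo]
  simp only [hQ, hPD, hQc _ _ h1' ho, hQc _ _ h2 ho, hPDc _ _ h1' ho, hPDc _ _ h2 ho,
    hPDc _ _ h1' hb, hPDc _ _ h2 hb, hT a₁ a₂ a₃ h1' h2 h3, hT a₂ a₁ a₃ h2 h1' h3, hc _ _ h2 hb,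
    hc _ _ h1' hb, hTc a₁ a₂ a₃ _ _ h1' h2 h3 h1' ho, hTc a₁ a₂ a₃ _ _ h1' h2 h3 h2 ho,
    hTc a₂ a₁ a₃ _ _ h2 h1' h3 h1' ho, hTc a₂ a₁ a₃ _ _ h2 h1' h3 h2 ho,
    hTc a₁ a₂ a₃ _ _ h1' h2 h3 h1' hb, hTc a₁ a₂ a₃ _ _ h1' h2 h3 h2 hb,
    hTc a₂ a₁ a₃ _ _ h2 h1' h3 h1' hb, hTc a₂ a₁ a₃ _ _ h2 h1' h3 h2 hb,
    hQcc _ _ _ _ h1' ho h1' hb, hQcc _ _ _ _ h2 ho h2 hb, hQcc _ _ _ _ h2 ho h1' hb,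
    hQcc _ _ _ _ h1' ho h2 hb,
    hPDcc _ _ _ _ h1' ho h1' hb, hPDcc _ _ _ _ h2 ho h1' hb, hPDcc _ _ _ _ h1' ho h2 hb,
    hPDcc _ _ _ _ h2 ho h2 hb,
    hTcc a₂ a₁ a₃ _ _ _ _ h2 h1' h3 h1' ho h1' hb, hTcc a₂ a₁ a₃ _ _ _ _ h2 h1' h3 h2 ho h1' hb,
    hTcc a₁ a₂ a₃ _ _ _ _ h1' h2 h3 h1' ho h2 hb, hTcc a₁ a₂ a₃ _ _ _ _ h1' h2 h3 h2 ho h2 hb,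
    hTcc a₁ a₂ a₃ _ _ _ _ h1' h2 h3 h1' ho h1' hb, hTcc a₁ a₂ a₃ _ _ _ _ h1' h2 h3 h2 ho h1' hb,
    hTcc a₂ a₁ a₃ _ _ _ _ h2 h1' h3 h1' ho h2 hb, hTcc a₂ a₁ a₃ _ _ _ _ h2 h1' h3 h2 ho h2 hb]

end Masses

section Leaf

variable {V : Type*} {E : Type*} [Fintype E] [DecidableEq E] [Fintype V] [DecidableEq V]
  {R : Type*} [Field R] [LinearOrder R] [IsStrictOrderedRing R]

omit [Fintype V] [DecidableEq V] [LinearOrder R] [IsStrictOrderedRing R] in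
/-- **An unmarked leaf is invisible to the cleared (HCOV) functional** (the companion of
`HMFLeafInvisible.HMFc_update_leaf`): `Gc (p[f ↦ t]) = Gc p` for the edge `f = {x, y}` of a leaf `x`
that is none of the marks. -/
theorem Gc_update_leaf (p : E → R) {ends : E → Sym2 V} {f : E} {x y : V} (hf : ends f = s(x, y))
    (hleaf : ∀ e, x ∈ ends e → e = f) (hxy : x ≠ y) {o a₁ a₂ a₃ b : V} (hxo : x ≠ o) (hx1 : x ≠ a₁)
    (hx2 : x ≠ a₂) (hx3 : x ≠ a₃) (hxb : x ≠ b) (t : R) :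
    Gc (Function.update p f t) ends o a₁ a₂ a₃ b = Gc p ends o a₁ a₂ a₃ b := by
  have hc : ∀ u v : V, u ≠ x → v ≠ x → Free f (connEvent ends u v) := fun u v hu hv =>
    free_connEvent hf hleaf hxy hu hv
  have hQ : Free f (avoidAll ends a₂ {a₁}) := by
    rw [avoidAll_eq_compl]; exact (hc a₁ a₂ hx1.symm hx2.symm).compl
  have hPD : Free f (PDEvent ends a₁ a₂ a₃) := by
    unfold PDEvent Dtilde inU
    exact (hc a₁ a₂ hx1.symm hx2.symm).compl.inter
      (HMFLeafInvisible.free_union (hc a₃ a₁ hx3.symm hx1.symm) (hc a₃ a₂ hx3.symm hx2.symm)).compl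
  have hT : Free f (TEvent ends a₁ a₂ a₃) := by
    unfold TEvent
    exact (hc a₂ a₁ hx2.symm hx1.symm).compl.inter (hc a₂ a₃ hx2.symm hx3.symm)
  have hT' : Free f (TEvent ends a₂ a₁ a₃) := by
    unfold TEvent
    exact (hc a₁ a₂ hx1.symm hx2.symm).compl.inter (hc a₁ a₃ hx1.symm hx3.symm)
  have key : ∀ A : Set (Config E), Free f A → prob (Function.update p f t) A = prob p A :=
    fun A hA => PendantEdm.prob_update_of_free p hA t
  have h1o := hc a₁ o hx1.symm hxo.symm
  have h2o := hc a₂ o hx2.symm hxo.symm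
  have h1b := hc a₁ b hx1.symm hxb.symm
  have h2b := hc a₂ b hx2.symm hxb.symm
  simp only [Gc, EQbo, EQb3, EQb3o, Do, gap, DEF, EQo, EQ3, EQ3o, PDb, PDbo]
  simp only [key _ hQ, key _ hPD, key _ hT, key _ hT', key _ h1b, key _ h2b,
    key _ (hQ.inter h1o), key _ (hQ.inter h2o), key _ (hPD.inter h1o), key _ (hPD.inter h2o),
    key _ (hPD.inter h1b), key _ (hPD.inter h2b),
    key _ (hT.inter h1o), key _ (hT.inter h2o), key _ (hT'.inter h1o), key _ (hT'.inter h2o),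
    key _ (hT.inter h1b), key _ (hT.inter h2b), key _ (hT'.inter h1b), key _ (hT'.inter h2b),
    key _ (hQ.inter (h1o.inter h1b)), key _ (hQ.inter (h2o.inter h2b)),
    key _ (hQ.inter (h2o.inter h1b)), key _ (hQ.inter (h1o.inter h2b)),
    key _ (hPD.inter (h1o.inter h1b)), key _ (hPD.inter (h2o.inter h1b)),
    key _ (hPD.inter (h1o.inter h2b)), key _ (hPD.inter (h2o.inter h2b)),
    key _ (hT'.inter (h1o.inter h1b)), key _ (hT'.inter (h2o.inter h1b)),
    key _ (hT.inter (h1o.inter h2b)), key _ (hT.inter (h2o.inter h2b)),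
    key _ (hT.inter (h1o.inter h1b)), key _ (hT.inter (h2o.inter h1b)),
    key _ (hT'.inter (h1o.inter h2b)), key _ (hT'.inter (h2o.inter h2b))]

end Leaf

section Contract

variable {V : Type*} {E : Type*} [Fintype E] [DecidableEq E] [Fintype V] [DecidableEq V]
  {R : Type*} [Field R] [LinearOrder R] [IsStrictOrderedRing R] {ends : E → Sym2 V} {v w w' : V}
  {f f' : E}

omit [Fintype E] [Fintype V] [DecidableEq V] in
/-- After the re-ending, `v` is a leaf with the single edge `f'`. -/
lemma leaf_of_reend (hdeg : ∀ e, v ∈ ends e → e = f ∨ e = f') (hvw : v ≠ w) (hvw' : v ≠ w') :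
    ∀ e, v ∈ (Function.update ends f s(w, w')) e → e = f' := by
  intro e he
  by_cases hef : e = f
  · rw [hef, Function.update_self] at he
    rcases Sym2.mem_iff.1 he with h | h
    · exact absurd h hvw
    · exact absurd h hvw'
  · rw [Function.update_of_ne hef] at he
    rcases hdeg e he with h | h
    · exact absurd h hef
    · exact h

/-- **THE SERIES CONTRACTION OF (HMF)**: an unmarked vertex `v` of degree two with edges
`f = {v, w}`, `f' = {v, w'}` is replaced by the single edge `{w, w'}` (re-ended `f`) of weight
`p f · p f'`, with `f'` deleted (weight `0`, `v` isolated). -/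
theorem HMF_series_contract (p : E → R) (hp : IsProbVec p) (hff : f ≠ f') (hf : ends f = s(v, w))
    (hf' : ends f' = s(v, w')) (hdeg : ∀ e, v ∈ ends e → e = f ∨ e = f') (hvw : v ≠ w)
    (hvw' : v ≠ w') {o a₁ a₂ a₃ b : V} (ho : o ≠ v) (h1 : a₁ ≠ v) (h2 : a₂ ≠ v) (h3 : a₃ ≠ v)
    (hb : b ≠ v) :
    HMF p ends o a₁ a₂ a₃ b ↔
      HMF (Function.update (Function.update p f (p f * p f')) f' 0)
        (Function.update ends f s(w, w')) o a₁ a₂ a₃ b := by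
  have hp₁ : IsProbVec (Function.update (Function.update p f (p f * p f')) f' 1) :=
    (hp.update f (mul_nonneg (hp.nonneg f) (hp.nonneg f'))
      (mul_le_one₀ (hp.le_one f) (hp.nonneg f') (hp.le_one f'))).update f' zero_le_one le_rfl
  have hs : (Function.update (Function.update p f (p f * p f')) f' 1) f' = 1 :=
    Function.update_self ..
  have hf'' : (Function.update ends f s(w, w')) f' = s(v, w') := by
    rw [Function.update_of_ne hff.symm, hf']
  have hp₂ : Function.update (Function.update p f (p f * p f')) f' 0 =
      Function.update (Function.update (Function.update p f (p f * p f')) f' 1) f' 0 :=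
    (Function.update_idem _ _ _).symm
  rw [← HMF_series_iff p hff hf hf' hdeg hvw hvw' ho h1 h2 h3 hb]
  unfold HMF
  rw [HMFc_reend_of_sure _ hp₁ hs hff hf hf' hdeg hvw hvw' ho h1 h2 h3 hb, hp₂,
    HMFLeafInvisible.HMFc_update_leaf _ hf'' (leaf_of_reend hdeg hvw hvw') hvw' ho.symm
      h1.symm h2.symm h3.symm hb.symm 0]

omit [Fintype V] [DecidableEq V] in
/-- **THE SERIES CONTRACTION OF (HCOV).** -/
theorem HCov_series_contract (p : E → R) (hp : IsProbVec p) (hff : f ≠ f') (hf : ends f = s(v, w))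
    (hf' : ends f' = s(v, w')) (hdeg : ∀ e, v ∈ ends e → e = f ∨ e = f') (hvw : v ≠ w)
    (hvw' : v ≠ w') {o a₁ a₂ a₃ b : V} (ho : o ≠ v) (h1 : a₁ ≠ v) (h2 : a₂ ≠ v) (h3 : a₃ ≠ v)
    (hb : b ≠ v) :
    HCov p ends o a₁ a₂ a₃ b ↔
      HCov (Function.update (Function.update p f (p f * p f')) f' 0)
        (Function.update ends f s(w, w')) o a₁ a₂ a₃ b := by
  have hp₁ : IsProbVec (Function.update (Function.update p f (p f * p f')) f' 1) :=
    (hp.update f (mul_nonneg (hp.nonneg f) (hp.nonneg f'))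
      (mul_le_one₀ (hp.le_one f) (hp.nonneg f') (hp.le_one f'))).update f' zero_le_one le_rfl
  have hs : (Function.update (Function.update p f (p f * p f')) f' 1) f' = 1 :=
    Function.update_self ..
  have hf'' : (Function.update ends f s(w, w')) f' = s(v, w') := by
    rw [Function.update_of_ne hff.symm, hf']
  have hp₂ : Function.update (Function.update p f (p f * p f')) f' 0 =
      Function.update (Function.update (Function.update p f (p f * p f')) f' 1) f' 0 :=
    (Function.update_idem _ _ _).symm
  rw [← HCov_series_iff p hff hf hf' hdeg hvw hvw' ho h1 h2 h3 hb]
  unfold HCov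
  rw [Gc_reend_of_sure _ hp₁ hs hf hf' hdeg hvw hvw' ho h1 h2 h3 hb, hp₂,
    Gc_update_leaf _ hf'' (leaf_of_reend hdeg hvw hvw') hvw' ho.symm h1.symm h2.symm h3.symm
      hb.symm 0]

end Contract

end SeriesCollapse

end Summit.Ventures.PercRepro2
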